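import Summits.BirchSwinnertonDyer.Rank1Residual.F1Sign2.LocalTowerSignLawAtTwo
import HarnessLib

/-!
# Cell `bsd-f1-sign2`, IMC-LTS at `f₂ = 3`: the `f₂ = 3` stratum of `LocalTowerSignLawAtTwo` as a PHASE-FREE law at every layer `n ≥ 2`, split by `v₂(j_W) ≥ 8` / `< 8` and, on `v₂(j_W) < 8`, by `Δ′_W mod 4` (-imc g9, MEMO-imc §10.74–§10.78; D-imc-34/35/36)

TYPER FILING (cell `bsd-f1-sign2`, seat `-ty` g10; CANDIDATES.md rows IMC-LTS-f3 / IMC-LTS-f3-Free / LA-3 / IMC-LTS-3⁰ (MZero) / IMC-LTS-3⁺ (MPos) / 3⁺-Unram / 3⁺-Ram; -imc g9 CANDIDATES-delta v3.2 + add1/add2 filing ask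
D-imc-36 (WIDENED 14:14:11Z → 91d270661699ded8; 14:23:16Z → sha of record b01e1783a5814bc5 = 8 defs + 17 theorems) «after REF1's check, append the three defs + five theorems VERBATIM to `F1Sign2/LocalTowerSignLawAtTwo.lean` (or sibling
`LocalTowerSignLawAtTwoCondThree.lean` importing it)» — typer's call: SIBLING, so that the REF1 §106/§110-certified statement file p636363 stays
byte-identical): `HOME/MEMO-imc-data/dimc35/lean/SketchG9CondThree.lean` b01e1783a5814bc5 (-imc: farm rc 0 · 0 err · 0 warn · 0 sorry `sketch-check4.json` b2e32222f87be1e5; BC7 3/3 CLEAN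
`ProbeG9CondThree.out` b494fc5649e28386 + 5/5 `ProbeG9CondThreeSplit.out` a098c53c78b966a5 + 7/7 `ProbeG9CondThreeRam.out` db94b2229f3a9baa) VERBATIM — same flat namespace `…Rank1Residual.F1Sign2`, same import.  Decls: `LocalTowerSignLawAtTwoCondThree`
(IMC-LTS at `f₂ = 3`, D-imc-34's tree target in LTS form), helpers `four_dvd_conductorNorm_of_conductorExponentAtTwo_eq_three`,
`newPartPhaseIndicator_eq_zero_of_conductorExponentAtTwo_eq_three`, PROVED `localTowerSignLawAtTwoCondThree_of_localTowerSignLawAtTwo`, support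
`LayerAdditiveAtCondThree` (LA-3), `LocalTowerSignLawAtTwoCondThreeFree` (hypothesis-free form) with PROVED glue `localTowerSignLawAtTwoCondThreeFree_of`,
`localTowerSignLawAtTwoCondThreeFree_of_localTowerSignLawAtTwo`; the §10.77 SPLIT: `LocalTowerSignLawAtTwoCondThreeMZero` (IMC-LTS-3⁰, hyp `8 ≤ v₂ j_W`: the
three `m = 0` classes III (4,5,4) / III (5,5,4) / I₁* (6,7,8) — PROVED IN WORDS by three `e`-uniform Tate runs, §10.77 (A1)–(A3)), `LocalTowerSignLawAtTwoCondThreeMPos`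
(IMC-LTS-3⁺, `v₂ j_W < 8`: classes I₁* (4,6,8) / III* (4,6,10) / II* (4,6,11) — OPEN = (B1) minimality + (G) «c(W^δ/K) = 4 ⟺ δ ∈ N(K(W[2])^×)»,
the one beyond-print statement left at `f₂ = 3`; D-imc-37 NARROWED to (B1) + (G)), with PROVED glue `localTowerSignLawAtTwoCondThreeFree_of_mZero_of_mPos`,
restrictions `…MZero_of_free` / `…MPos_of_free`, and `…MPos_of_localTowerSignLawAtTwo`; the §10.78 SPLIT of the `m > 0` half by the residue of the odd part of
`Δ_W` mod 4: carrier `DiscOddPartOneModFour` (`Δ_W = 2^k·a/b`, `ab ≡ 1 (4)`; isomorphism-invariant), `LocalTowerSignLawAtTwoCondThreeMPosUnram` (`Δ′_W ≡ 1 (4)`: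
PROVED IN WORDS §10.78 (B1)+(U), minimal `I*_ν`, `c = |W(K)[2]|`; 387/592 sweep models), `LocalTowerSignLawAtTwoCondThreeMPosRam` (`Δ′_W ≡ 3 (4)`: the RESIDUAL crux of
the `f₂ = 3` rung — «`c(W^δ/K) = 4 ⟺ Δ′_W ≡ 7 (8) ⟺ K(W[2]) = ℚ₂(ζ_{2^{n+1}})`», §10.78 (R), OPEN; 205/592), glue `…MPos_of_unram_of_ram`, `…Unram_of_mPos`,
`…Ram_of_mPos`, `…Free_of_mZero_of_unram_of_ram`, `…MPosRam_of_localTowerSignLawAtTwo` PROVED.  No new `@[conjecture]` (every rung follows from IMC-LTS (+ LA-3)).  Typer edits =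
this header and the REF1/REF2 sentences.  Nothing is asserted.
Census = BC5 WITNESS: D-imc-35 EXHAUSTIVE 2-ADIC CLASS SWEEP (pre-registration `HOME/MEMO-imc-data/dimc35/README-35.md` 35b247b30c60ab5a; kit j309773,
tag `bsd-frontier-data`, 32 cores × 509 s, 0 errors; nr supplement j310010 two engines 321 728/321 728 agree): every `E/ℚ₂` up to `ℚ₂`-isomorphism at
resolution `(A mod 2^(v(A)+6), B mod 2^(v(B)+6))` — 321 728 short-Weierstrass models, tower `n ≤ 5`: K35-1 LTS 1 090 112 (model, n) cells in range,
0 violations; K35-2 KTD 1 532 960 cells 0; K35-3 (T_n) 0; 78 effective local classes (50 pot. good + 28 pot. mult. families), all 13 infinite Tate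
families in their periodic regime; `f₂ = 3` ⟺ EXACTLY the six Kraus classes of §10.74 (4 432 models: III (4,5,4) 768 · III (5,5,4) 1 536 · I₁* (6,7,8)
1 536 · I₁* (4,6,8) 192 · III* (4,6,10) 224 · II* (4,6,11) 176), all six layers additive with `f(W/L_k) = 3` for every `k ≤ 5` (26 592 layer cells).
THEORY (§10.76): (a) `f₂ = 3` ⟺ `σ_W|_I` has the single break ½ (GKM L.1.11) ⟺ Φ = SL₂(𝔽₃) ⇒ every layer additive, `f = 3` (= LA-3); (b3) -desc's (F)
is a theorem of GKM L.1.3 + Serre LF IV §4 (priority -desc §23-add1 (F♯)); (b4) the typed RANGE `f₂ ≤ 2n+2` and PHASE `[f₂ = 2n+2]` of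
`LocalTowerSignLawAtTwo` ARE Deligne's stability inequality `sw(η_n) = 2^n` vs `2ψ_{L_{n−1}}(u_W)`.
REF1-AUDIT §116 (refuter-bsd-f1-sign2-ref1 g10, 2026-08-28T14:38:48Z; evidence `HOME/REF1-data/b116/`; D-imc-35-R1 ANSWERED; gate D-ty-ref1-30 CLEARED: draft 413bbaa2a9fb51a7 = sketch b01e1783a5814bc5, cmpdecls 22/22): «`SketchG9CondThree.lean` b01e1783a5814bc5 = draft 413bbaa2a9fb51a7 (22/22) — all eight rows SURVIVE: CondThree/Free/MPos/MPosRam conjecture-grade (MPosRam = residual (R), OPEN), LayerAdditiveAtCondThree theorem-grade in print (SL₂(𝔽₃)), MZero and MPosUnram THEOREM-GRADE IN SUBSTANCE (§10.77 (A1)–(A3) and §10.78 (B1)/(TYPE)/(U) certified step by step by REF1; inputs (KTD_n), (F), coverage lemma r2); carrier `DiscOddPartOneModFour` correct (kernel-checked instances both ways); 14 theorems trio; KILLED none; rc 0; REF1 replay of kit j309773: K35-1 1 090 112 / K35-2 1 532 960 / K35-3 1 090 112 cells, 0 violations; f₂ = 3 = six classes 4 432 models; (A) 15 360 + (B) 2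 368 deep-twist cells as derived, 0 mismatches; (U):(R) = 387:205; 2 ≤ n load-bearing (n = 1 fails on 2 896/4 432).» Typer uptake: r1 one-line glue `localTowerSignLawAtTwoCondThree_of_free` ADDED below (REF1 e1; so e2: MZero → MPosUnram → MPosRam → `LocalTowerSignLawAtTwoCondThree` with no LA-3, `localTowerSignLawAtTwoCondThree_of_mZero_of_unram_of_ram`); r3 folded in MZero's docstring; r2 (COVERAGE LEMMA: the words-proofs are proofs for `W` whose normalised short model has `(v₂A, v₂B) ∈ {(0,0), (1,0), (2,2)}` (MZero) resp. `= (0,1)` with `v₂(A³+27B₁²) ∈ {2,4,5}` (MPos); «`f₂ = 3 ∧ v₂ j ≥ 8` (resp. `< 8`)» ⟹ these patterns is the sweep's coverage statement — in print a table lookup, Papadopoulos 1993 Table IV / Kraus 1990, acq-00718; a kernel proof of MZero/Unram needs it as a lemma) and r7 ((R) intrinsically reads `c = 4 ⟺ δ ∈ N(K(W[2])^×)` = -imc §10.79 (G-natural), not «Δ′ mod 8») recorded for the prover; mutation: `2 ≤ n` LOAD-BEARING.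
REF2-PLACEMENT: (T_n) ⟺ IMC-LTS placed in v28 §1 (NEW-COMBINATION, not in print for pot. good `f₂ ≥ 3`); D-imc-35-R2 (§10.76 (a)/(b3)/(b4) + Q76.1, §10.77 (A), (G)) ANSWERED by -ref2 g32 = REF2-PLACEMENT v32 §1 (`HOME/REF2-PLACEMENT-v32.md` 41962dcf81f63fad, 2026-08-28T14:47:56Z): «(B1) minimality KNOWN-elementary (five lines on AEC VII.1.3(d) + Table 3.1; holds over EVERY 2-adic DVR — `e ≥ 2` unused; Kraus 1989 Thm 2 equivalent); (TYPE) `I*_ν, ν = (v₂Δ_W − 4)·e, c ∈ {2,4}` in-print ASSEMBLY → VARIANT (Katz GKM L.1.3 + (B1) + Ogg–Saito + ATAEC IV.9.4 Step 7; Wang 2024 Cor. 2.12, Lorenzini 2010 Thm 2.8 inapplicable at e(W) = 24; Comalada 1994 char-2 rows flagged erroneous by Barrios et al. 2025 p. 4; Barrios 2025 Thm 3 is K = ℚ₂ only); (U) mechanism KNOWN-elementary, closed form VARIANT (§1.3, on `…MPosUnram` below); (R) NOT IN PRINT, conjecture-grade, NEW-COMBINATION-small, beyond-print yes-small IF proved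 (§1.4, on `…MPosRam` below); §10.79 (G) road = KNOWN (S1: DD 2015 Lemma 10(2) = Schaefer 1996 L.3.8) + KNOWN (S2: AEC X.4.9 φ-descent + norm-form torsor) + OPEN (S3 = (R) in descent currency); PARTITION none moved; beyond-print theorem none landed.» -imc §10.80 (INBOX 14:44:35Z, MEMO-imc 382f2382e120bab8): (R) PROVED IN WORDS (2-isogeny descent in nine finite steps; `2 ∣ e` load-bearing) — CERTIFIED by REF1 §119 (15:07:12Z, -ref1 g11; replay `REF1-data/b119/replay119.py` 9817b69920b2285f): the whole f₂ = 3 rung (T_n)^{f₂=3} = `LocalTowerSignLawAtTwoCondThree` is PROVED IN WORDS for every n ≥ 2 (ledger: beyond-print theorem «no» until D-imc-37 lands it in Lean). Earlier context (REF1 §116 cc to -ref2): r2's coverage lemma is the one print input of the words-proofs (Papadopoulos 1993 Table IV / Kraus 1990, acq-00718); -imc §10.79 (via INBOX 14:33:03Z): (G) c(W^δ/K) = 3 + (δ, Disc_W)_K holds on 20 800/20 800 odd-valuation m > 0 rows over 13 tested 2-adic fields with e EVEN and FAILS only in class (4,6,11) for e ODD (any proof must use 2 ∣ e); Dokchitser–Dokchitser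 2015 Table 1 leaves exactly the cell «additive pot. good, l = p, pot. supersingular WILD» open. [cite: KramerTunnell1982, Thm. 7.6] [cite: DokchitserDokchitser2011, Thm. 5]
PARTITION: none moved (frontier tier; the `f₂ = 3` stratum = -imc's FIRST TARGET on the additive third; D-imc-37: (TY)^{f₂=3} = six Tate runs with
`e` symbolic closes `LocalTowerSignLawAtTwoCondThreeFree` modulo formalisation); beyond-print theorem: no (yes-small if proved).  BSD is not proved by any
of this.
bears_on: F1Sign2 leaf (IMC-LTS p636363; -desc (T)/(TY) `DeepTwistLawsAtTwo`); asks D-imc-35-R1 (REF1), D-imc-35-R2 (REF2), D-imc-37 (prover).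

## The sketch's own summary (verbatim)

# Sketch (-imc g9, D-imc-34/35): the `f₂ = 3` stratum of IMC-LTS as a PHASE-FREE law at every layer `n ≥ 2`
(`conductorExponentAtTwo W = 3`: types III / I₁* / III* / II* with `(v c₄, v c₆, v Δ)` in the six Kraus classes of MEMO-imc §10.74;
`3 < 2n+2` for every `n ≥ 1`, so the phase `X_n = 0` and the range hypothesis is automatic). Tree helpers only; nothing asserted.
-/

noncomputable section

open scoped Classical

open WeierstrassCurve Literature.NumberTheory.EllipticCurves Literature.NumberTheory.EllipticCurves.Rank1Residual ZpExtension

namespace Summit.BirchSwinnertonDyer.Rank1Residual.F1Sign2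

/-- **IMC-LTS at `f₂ = 3`** (`LocalTowerSignLawAtTwoCondThree`, D-imc-34's tree target in LTS form): for `W/ℚ` with conductor
exponent `3` at `2`, the cyclotomic `ℤ₂`-tower `κ`, every `n ≥ 2` with layers `n − 1`, `n` additive above `2`:
`J_n = δu_n + δTam_n` is even iff `ρ₂(W) = +1`.  Equivalent in print (KT82 Thm 7.6 ∘ DD11 Thm 5, identity (KTD_n)) to
(T_n)^{f₂=3}: `ord₂ C(W ⊗ η_n / L_{n−1}, ω_{A′}) ≡ [Δ′_W ≡ ±3 (mod 8)] (mod 2)`. -/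
def LocalTowerSignLawAtTwoCondThree : Prop :=
  ∀ (W : WeierstrassCurve ℚ) [W.IsElliptic], conductorExponentAtTwo W = 3 →
    ∀ (κ : ZpExtension ℚ 2), κ.IsCyclotomic →
    ∀ n : ℕ, 2 ≤ n →
      LayerAdditiveAboveTwo W κ (n - 1) → LayerAdditiveAboveTwo W κ n →
      (Even (towerCorrectionJumpAtTwo W κ n) ↔ twoAdicTwistSign W = 1)

/-- `f₂ = 3 ⇒ 4 ∣ N_W` (indeed `8 ∣ N_W`). -/
theorem four_dvd_conductorNorm_of_conductorExponentAtTwo_eq_three (W : WeierstrassCurve ℚ)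
    (h3 : conductorExponentAtTwo W = 3) : 4 ∣ W.conductorNorm ℤ := by
  have h8 : 2 ^ 3 ∣ W.conductorNorm ℤ := by
    have h := Nat.ordProj_dvd (W.conductorNorm ℤ) 2
    unfold conductorExponentAtTwo at h3
    rwa [h3] at h
  exact dvd_trans ⟨2, by norm_num⟩ h8

/-- At `f₂ = 3` the phase indicator vanishes at every layer. -/
theorem newPartPhaseIndicator_eq_zero_of_conductorExponentAtTwo_eq_three (W : WeierstrassCurve ℚ)
    (h3 : conductorExponentAtTwo W = 3) (n : ℕ) : newPartPhaseIndicator W n = 0 := by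
  unfold newPartPhaseIndicator
  rw [if_neg]
  omega

/-- IMC-LTS ⇒ its `f₂ = 3` stratum (pure bookkeeping: `8 ∣ N`, `3 ≤ 2n+2`, `X_n = 0`). -/
theorem localTowerSignLawAtTwoCondThree_of_localTowerSignLawAtTwo (h : LocalTowerSignLawAtTwo) :
    LocalTowerSignLawAtTwoCondThree := by
  intro W _ h3 κ hκ n hn ha hb
  have h4 := four_dvd_conductorNorm_of_conductorExponentAtTwo_eq_three W h3
  have hf : conductorExponentAtTwo W ≤ 2 * n + 2 := by omega
  have hX := newPartPhaseIndicator_eq_zero_of_conductorExponentAtTwo_eq_three W h3 n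
  have key := h W h4 κ hκ n hn hf ha hb
  simpa [hX] using key


/-- **Layers are additive at `f₂ = 3`** (`LayerAdditiveAtCondThree`; support row, provable in print: `f₂ = 3` ⇔ `sw(σ_W) = 1` ⇔
`σ_W|_I` has the single break `1/2` (Katz GKM 1.11) ⇒ inertia image `SL₂(𝔽₃)`, linearly disjoint from the `2`-power cyclotomic layers,
and `ψ_{L_k/ℚ₂}(1/2) = 1/2` ⇒ `f(W/L_k) = 3` at every layer; D-imc-35 sweep: 4 432 models × 6 layers, all additive, all `f = 3`). -/
def LayerAdditiveAtCondThree : Prop :=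
  ∀ (W : WeierstrassCurve ℚ) [W.IsElliptic], conductorExponentAtTwo W = 3 →
    ∀ (κ : ZpExtension ℚ 2), κ.IsCyclotomic → ∀ k : ℕ, LayerAdditiveAboveTwo W κ k

/-- **IMC-LTS at `f₂ = 3`, hypothesis-free form** (`LocalTowerSignLawAtTwoCondThreeFree`): for `W/ℚ` with conductor exponent `3`
at `2` and every layer `n ≥ 2` of the cyclotomic `ℤ₂`-tower, `J_n` is even iff `ρ₂(W) = +1` — no range, no phase, no additivity
hypothesis (all automatic at `f₂ = 3`). -/
def LocalTowerSignLawAtTwoCondThreeFree : Prop :=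
  ∀ (W : WeierstrassCurve ℚ) [W.IsElliptic], conductorExponentAtTwo W = 3 →
    ∀ (κ : ZpExtension ℚ 2), κ.IsCyclotomic →
    ∀ n : ℕ, 2 ≤ n → (Even (towerCorrectionJumpAtTwo W κ n) ↔ twoAdicTwistSign W = 1)

/-- Glue: the `f₂ = 3` stratum of IMC-LTS plus layer additivity at `f₂ = 3` give the hypothesis-free form. -/
theorem localTowerSignLawAtTwoCondThreeFree_of (h : LocalTowerSignLawAtTwoCondThree)
    (hadd : LayerAdditiveAtCondThree) : LocalTowerSignLawAtTwoCondThreeFree := by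
  intro W _ h3 κ hκ n hn
  exact h W h3 κ hκ n hn (hadd W h3 κ hκ (n - 1)) (hadd W h3 κ hκ n)

/-- And from the tree law directly. -/
theorem localTowerSignLawAtTwoCondThreeFree_of_localTowerSignLawAtTwo (h : LocalTowerSignLawAtTwo)
    (hadd : LayerAdditiveAtCondThree) : LocalTowerSignLawAtTwoCondThreeFree :=
  localTowerSignLawAtTwoCondThreeFree_of (localTowerSignLawAtTwoCondThree_of_localTowerSignLawAtTwo h) hadd


/-! ## The `f₂ = 3` stratum split by the twist's component number `m = max(0, 8 − v₂ j) · 2^{n−1}` (-desc §23 (TY))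

At `f₂ = 3` the six 2-adic classes (D-imc-35, exhaustive) have `v₂(j_W) ∈ {8, 11, 10}` (III `(4,5,4)`, III `(5,5,4)`,
I₁* `(6,7,8)`: the deep twist has type `I₀*`, `I₀*`, `II/II*` — component number `m = 0`) or `v₂(j_W) ∈ {4, 2, 1}`
(I₁* `(4,6,8)`, III* `(4,6,10)`, II* `(4,6,11)`: type `I*_{(8 − v₂ j)·2^{n−1}}`, `m > 0`).  MEMO-imc §10.77 PROVES the
`m = 0` half in words (three `e`-uniform runs of Tate's algorithm over `L_{n−1}`); the `m > 0` half is the residual crux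
(`c′ = 3 + (Δ_W, 2)₂` for the `I*_{m}` twist).  `j_W ≠ 0` on the stratum (`v₂ c₄ < ∞` in all six classes), so `padicValRat 2 W.j`
carries no junk case here. -/

/-- **IMC-LTS-3⁰** (`m = 0` half of the `f₂ = 3` stratum: `v₂(j_W) ≥ 8`; classes III (4,5,4), III (5,5,4), I₁* (6,7,8);
3 840 of the 4 432 sweep models; PROVED IN WORDS in MEMO-imc §10.77 via (KTD_n) + Tate's algorithm, all `n ≥ 2`).
REF1 §116: THEOREM-GRADE IN SUBSTANCE (§10.77 (A1)–(A3) certified step by step); r3: the three classes = `f₂ = 3 ∧ v₂ j ∈ {8, 11, 10}`; the threshold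
`8 ≤ v₂ j` is free in `(4, 8]`; `2 ≤ n` is load-bearing (n = 1 fails on 2 896/4 432 models). -/
def LocalTowerSignLawAtTwoCondThreeMZero : Prop :=
  ∀ (W : WeierstrassCurve ℚ) [W.IsElliptic], conductorExponentAtTwo W = 3 → 8 ≤ padicValRat 2 W.j →
    ∀ (κ : ZpExtension ℚ 2), κ.IsCyclotomic →
    ∀ n : ℕ, 2 ≤ n → (Even (towerCorrectionJumpAtTwo W κ n) ↔ twoAdicTwistSign W = 1)

/-- **IMC-LTS-3⁺** (`m > 0` half: `v₂(j_W) < 8`, in fact `∈ {1, 2, 4}`; classes I₁* (4,6,8), III* (4,6,10), II* (4,6,11);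
592 sweep models; deep twist of type `I*_{(8 − v₂ j)·2^{n−1}}` with `c′ ∈ {2, 4}`; OPEN = the residual crux at `f₂ = 3`:
`c′ = 3 + (Δ_W, 2)₂`, -desc (TY)(b)). -/
def LocalTowerSignLawAtTwoCondThreeMPos : Prop :=
  ∀ (W : WeierstrassCurve ℚ) [W.IsElliptic], conductorExponentAtTwo W = 3 → padicValRat 2 W.j < 8 →
    ∀ (κ : ZpExtension ℚ 2), κ.IsCyclotomic →
    ∀ n : ℕ, 2 ≤ n → (Even (towerCorrectionJumpAtTwo W κ n) ↔ twoAdicTwistSign W = 1)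

/-- Glue: the two halves give the hypothesis-free `f₂ = 3` law. -/
theorem localTowerSignLawAtTwoCondThreeFree_of_mZero_of_mPos
    (h0 : LocalTowerSignLawAtTwoCondThreeMZero) (hp : LocalTowerSignLawAtTwoCondThreeMPos) :
    LocalTowerSignLawAtTwoCondThreeFree := by
  intro W _ h3 κ hκ n hn
  by_cases h : 8 ≤ padicValRat 2 W.j
  · exact h0 W h3 h κ hκ n hn
  · exact hp W h3 (lt_of_not_ge h) κ hκ n hn

/-- Glue (REF1 §116 r1 = e1, typer-added one-liner): the hypothesis-free law gives the `f₂ = 3` stratum of IMC-LTS (the additivity hypotheses are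
simply not used); with `localTowerSignLawAtTwoCondThreeFree_of_mZero_of_unram_of_ram` this is e2: MZero → MPosUnram → MPosRam → CondThree, no LA-3. -/
theorem localTowerSignLawAtTwoCondThree_of_free (h : LocalTowerSignLawAtTwoCondThreeFree) :
    LocalTowerSignLawAtTwoCondThree :=
  fun W _ h3 κ hκ n hn _ _ => h W h3 κ hκ n hn

/-- Converse bookkeeping: the free law restricts to each half. -/
theorem localTowerSignLawAtTwoCondThreeMZero_of_free (h : LocalTowerSignLawAtTwoCondThreeFree) :
    LocalTowerSignLawAtTwoCondThreeMZero :=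
  fun W _ h3 _ κ hκ n hn => h W h3 κ hκ n hn

/-- Converse bookkeeping: the free law restricts to the `m > 0` half. -/
theorem localTowerSignLawAtTwoCondThreeMPos_of_free (h : LocalTowerSignLawAtTwoCondThreeFree) :
    LocalTowerSignLawAtTwoCondThreeMPos :=
  fun W _ h3 _ κ hκ n hn => h W h3 κ hκ n hn

/-- Hence IMC-LTS (+ layer additivity at `f₂ = 3`) already gives both halves. -/
theorem localTowerSignLawAtTwoCondThreeMPos_of_localTowerSignLawAtTwo (h : LocalTowerSignLawAtTwo)
    (hL : LayerAdditiveAtCondThree) : LocalTowerSignLawAtTwoCondThreeMPos :=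
  localTowerSignLawAtTwoCondThreeMPos_of_free (localTowerSignLawAtTwoCondThreeFree_of_localTowerSignLawAtTwo h hL)

/-! ## §10.78 split of the `m > 0` half by the residue of the odd part of `Δ_W` mod 4

`Δ′_W ≡ 1 (mod 4)` ⟺ `K(√Δ_W)/K` is unramified-or-trivial over every layer field `K = ℚ_{n-1}` (`n ≥ 2`); there the twist
Tamagawa number is read off `W(K)[2] ↪ Φ` (MEMO-imc §10.78 (U), proved in words).  `Δ′_W ≡ 3 (mod 4)` is the ramified
residual (§10.78 (R), open).  The predicate below is an isomorphism invariant (`Δ ↦ u¹²Δ`, odd squares are `1 mod 8`). -/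

/-- `Δ′_W ≡ 1 (mod 4)`: the model discriminant is `2^k · a/b` with `a·b ≡ 1 (mod 4)` (then `a`, `b` are odd, `k = v₂(Δ_W)` and
`a·b ≡ Δ′_W (mod 8)`). Its negation means `Δ′_W ≡ 3 (mod 4)` as soon as `Δ_W ≠ 0`. -/
def DiscOddPartOneModFour (W : WeierstrassCurve ℚ) : Prop :=
  ∃ (k : ℤ) (a b : ℤ), W.Δ = (2 : ℚ) ^ k * a / b ∧ a * b % 4 = 1

/-- `m > 0` half, UNRAMIFIED sub-case (`Δ′_W ≡ 1 (mod 4)`; classes I₁* (4,6,8) entirely, half of III* (4,6,10) and II* (4,6,11);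
387/592 sweep models): PROVED IN WORDS (§10.78 (B1)+(U)): the deep twist is minimal of type `I*_ν`, and `c = |W(K)[2]|`.
REF2 v32 §1.3: mechanism KNOWN-elementary (2-torsion of the twist misses the identity component ⟹ `W^δ(K)[2] ↪ Φ(k)`; Φ étale, unramified
base change; Hensel) — the residue-characteristic-2 analogue of Lorenzini 2011 AIF 61 Prop. 3.1 (printed for torsion prime to p only); closed
form not printed: VARIANT; beyond-print no.  (Same injection found chart-level by -desc g15 as T2Φ, REF2 v32 §2.2.)
[cite: Lorenzini2011TorsionTamagawa, Prop. 3.1] -/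
def LocalTowerSignLawAtTwoCondThreeMPosUnram : Prop :=
  ∀ (W : WeierstrassCurve ℚ) [W.IsElliptic], conductorExponentAtTwo W = 3 → padicValRat 2 W.j < 8 →
    DiscOddPartOneModFour W →
    ∀ (κ : ZpExtension ℚ 2), κ.IsCyclotomic → ∀ n : ℕ, 2 ≤ n →
      (Even (towerCorrectionJumpAtTwo W κ n) ↔ twoAdicTwistSign W = 1)

/-- `m > 0` half, RAMIFIED sub-case (`Δ′_W ≡ 3 (mod 4)`; 205/592 sweep models, classes III* (4,6,10) and II* (4,6,11) only):
the residual crux of the `f₂ = 3` rung — `c(W^δ/K) = 4 ⟺ Δ′_W ≡ 7 (mod 8) ⟺ K(W[2]) = ℚ₂(ζ_{2^{n+1}})` (§10.78 (R)).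
REF2 v32 §1.4: NOT IN PRINT — Dokchitser–Dokchitser 2015 (Acta Arith. 173) Table 1 leaves the potentially-supersingular wild cell
undetermined («?»); no printed twist table has this scope (Comalada 1994 char-2 rows flagged erroneous by Barrios et al. 2025; Barrios 2025
Thm 3 is K = ℚ₂ only); root numbers (DD 2008) give an equivalent, not a proof (KT82 7.6 + DD11 Thm 5 = (KTD_n)).  Conjecture-grade, census
205 × 4 layers 0 exceptions; NEW-COMBINATION-small; beyond-print yes-small if proved.  -imc §10.80 (14:44:35Z): announced PROVED IN WORDS by a
2-isogeny descent in nine finite steps (`E′ = E/⟨P₀⟩` is the twist of a SPLIT (4,6,8) or (4,6,10) curve, so `c(E′) = 4` by (U); DD 2015 Lemma 10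
⟹ `|E(K)/φ̂E′(K)| = c(E)/2`; Kummer image of `P₀` trivial; `2 ∣ e` used) — REF1 audit pending; the statement below is unchanged either way.
«REF2 v32 add-1 (§A1.6): words-proved by -imc §10.80 (2-isogeny descent: DD 2015 Lemma 10(2) = Schaefer 1996 L.3.8, AEC X.4.9 Kummer map,
Hilbert-symbol projection formula; “e even, K totally ramified” load-bearing) — statement NOT IN PRINT (DD 2015 Table 1 open cell), levers in
print; NEW-COMBINATION-small; beyond-print theorem-candidate yes-small pending REF1 + Lean.»
«REF1 §119 (refuter-bsd-f1-sign2-ref1 g11, 2026-08-28T15:07:12Z): MEMO-imc §10.80 (0)–(9) CERTIFIED line by line (2-isogeny descent: b ≡ 1 (8);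
E′ = u′=2-inflation of the minimal (W″)^δ, W″ ∈ (4,6,8), (4,6,10) split; c(E′) = 4; α_φ̂ = 1; |E(K)/φ̂E′(K)| = c(E)/2 = |im κ|; only v(x) = 1
points are non-squares; v = 1 points ⟺ [ρ² − D₂] = [δ]s₀, s₀ ∈ {[−a/2], [−a/2]u_nr} independent of ρ; norm lemma; (s₀, Δ_W)_K = 1 by the
projection formula, e even) ⟹ (G♮) c(W^δ/K) = 3 + (δ, Δ_W)_K and (R) THIS ROW THEOREM-GRADE IN SUBSTANCE — PROVED IN WORDS; rung (T_n)^{f₂=3}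
proved in words ∀ n ≥ 2; (F_K) dischargeable by (F♯); f₂ = 3 not load-bearing given e even (f₂ = 4 twins corollary); replay of dimc38: norms
30 464/30 464, symbols 30 464/30 464, law 17 920/17 920 on scope, TYPE, f, vu exact, isog 3 600/3 600; KILLED none; r1: no re-typing — the
statement stands, `@[conjecture]` tag kept (append-only attribute rule) until D-imc-37 lands `(G♮) → …MPosRam` sorry-free.»
[cite: DokchitserDokchitser2011, Thm. 5] -/
def LocalTowerSignLawAtTwoCondThreeMPosRam : Prop :=
  ∀ (W : WeierstrassCurve ℚ) [W.IsElliptic], conductorExponentAtTwo W = 3 → padicValRat 2 W.j < 8 →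
    ¬ DiscOddPartOneModFour W →
    ∀ (κ : ZpExtension ℚ 2), κ.IsCyclotomic → ∀ n : ℕ, 2 ≤ n →
      (Even (towerCorrectionJumpAtTwo W κ n) ↔ twoAdicTwistSign W = 1)

/-- Glue (PROVED): the two sub-cases give the `m > 0` half. -/
theorem localTowerSignLawAtTwoCondThreeMPos_of_unram_of_ram
    (hu : LocalTowerSignLawAtTwoCondThreeMPosUnram) (hr : LocalTowerSignLawAtTwoCondThreeMPosRam) :
    LocalTowerSignLawAtTwoCondThreeMPos := by
  intro W _ h3 hj κ hκ n hn
  by_cases h : DiscOddPartOneModFour W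
  · exact hu W h3 hj h κ hκ n hn
  · exact hr W h3 hj h κ hκ n hn

/-- Restriction: the `m > 0` half gives its unramified sub-case. -/
theorem localTowerSignLawAtTwoCondThreeMPosUnram_of_mPos (h : LocalTowerSignLawAtTwoCondThreeMPos) :
    LocalTowerSignLawAtTwoCondThreeMPosUnram :=
  fun W _ h3 hj _ κ hκ n hn => h W h3 hj κ hκ n hn

/-- Restriction: the `m > 0` half gives its ramified sub-case. -/
theorem localTowerSignLawAtTwoCondThreeMPosRam_of_mPos (h : LocalTowerSignLawAtTwoCondThreeMPos) :
    LocalTowerSignLawAtTwoCondThreeMPosRam :=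
  fun W _ h3 hj _ κ hκ n hn => h W h3 hj κ hκ n hn

/-- The whole `f₂ = 3` rung from the three pieces: `m = 0` (words-proved), `m > 0` unramified (words-proved), ramified (open). -/
theorem localTowerSignLawAtTwoCondThreeFree_of_mZero_of_unram_of_ram
    (h0 : LocalTowerSignLawAtTwoCondThreeMZero) (hu : LocalTowerSignLawAtTwoCondThreeMPosUnram)
    (hr : LocalTowerSignLawAtTwoCondThreeMPosRam) : LocalTowerSignLawAtTwoCondThreeFree :=
  localTowerSignLawAtTwoCondThreeFree_of_mZero_of_mPos h0 (localTowerSignLawAtTwoCondThreeMPos_of_unram_of_ram hu hr)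

/-- And IMC-LTS (+ layer additivity at `f₂ = 3`) gives the ramified residual, so it is a genuine piece of the row of record. -/
theorem localTowerSignLawAtTwoCondThreeMPosRam_of_localTowerSignLawAtTwo (h : LocalTowerSignLawAtTwo)
    (hL : LayerAdditiveAtCondThree) : LocalTowerSignLawAtTwoCondThreeMPosRam :=
  localTowerSignLawAtTwoCondThreeMPosRam_of_mPos (localTowerSignLawAtTwoCondThreeMPos_of_localTowerSignLawAtTwo h hL)

end Summit.BirchSwinnertonDyer.Rank1Residual.F1Sign2

end
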